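import Mathlib

/-!
# Crux `SelfMixingDichotomy.CoherentScaleExclusion` (stmt-NavierStokesRegularity-1423), line
  `registered`: stub `kinWitness_pointwise` — pointwise and energy facts of the kinematic witness

Lands `--supports stmt-NavierStokesRegularity-1423` the registered stub `kinWitness_pointwise` of
the lead's kinematic-witness package: the swirling core
`uW t x = (1 - t) ^ (-7/8) · expNegInvGlue (4 - ‖x‖² / (1 - t) ^ (3/4)) • J x` for `t < 1`
(and `0` for `t ≥ 1`), where `J x = (-x₁, x₀, 0) = WithLp.toLp 2 ![-(x 1), x 0, 0]`, with core
radius `ρ(t) = (1 - t) ^ (3/8)` (`ρ² = (1 - t) ^ (3/4)`).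

Three facts are recorded (the registered statement writes the lambda out four times):
1. SUPPORT: for `t < 1` and `‖x‖ ≥ 2ρ(t)` the field vanishes (`‖x‖² ≥ 4ρ²`, so the argument of
   `expNegInvGlue` is `≤ 0`, `expNegInvGlue.zero_of_nonpos`).
2. TYPE-I BOUND: for `t < 1`, `√(1 - t) · ‖uW t x‖ ≤ 2` (`expNegInvGlue ≤ 1`, `‖J x‖ ≤ ‖x‖ < 2ρ`
   on the support, and `√s · s^(-7/8) · 2 s^(3/8) = 2`).
3. ENERGY: for `t ≥ 0` every time slice is in `L²` with `∫ ‖uW t x‖² ≤ 32 · |B₁|`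
   (`|B₁| = (volume (ball 0 1)).toReal`): for `t ≥ 1` the slice is `0`; for `0 ≤ t < 1` it is
   continuous with support in `closedBall 0 (2ρ)` (`Continuous.memLp_of_hasCompactSupport`), and
   `‖uW‖² ≤ 4/(1 - t)` on `ball 0 (2ρ)` gives `∫ ‖uW‖² ≤ 4/(1-t) · (2ρ)³ |B₁| = 32 (1-t)^(1/8) |B₁|`
   (`Measure.addHaar_ball`, `finrank_euclideanSpace_fin`).

Only Mathlib is used. The helper theorems are stated for a generic parameter `s = 1 - t > 0`.
-/

noncomputable section

open MeasureTheory Metric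

-- `Summit = Problem` for this summit; the tree lakefile sets `weak.linter.dupNamespace = false`.
set_option linter.dupNamespace false

namespace Summit.NavierStokesRegularity.NavierStokesRegularity.Theorems

/-- The rotation field `J x = (-x₁, x₀, 0)` satisfies `‖J x‖ ≤ ‖x‖` on `ℝ³`. -/
theorem kinWitness_pointwise_norm_rot_le (x : EuclideanSpace ℝ (Fin 3)) :
    ‖(WithLp.toLp 2 ![-(x 1), x 0, 0] : EuclideanSpace ℝ (Fin 3))‖ ≤ ‖x‖ := by
  rw [← sq_le_sq₀ (norm_nonneg _) (norm_nonneg _), EuclideanSpace.real_norm_sq_eq,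
    EuclideanSpace.real_norm_sq_eq, Fin.sum_univ_three, Fin.sum_univ_three]
  simp only [Matrix.cons_val_zero, Matrix.cons_val_one, Matrix.cons_val]
  nlinarith [sq_nonneg (x 2)]

/-- Exponent bookkeeping: `√s · (s^(-7/8) · (2 s^(3/8))) = 2` for `s > 0`
(`1/2 - 7/8 + 3/8 = 0`). -/
theorem kinWitness_pointwise_rpow_cancel {s : ℝ} (hs : 0 < s) :
    Real.sqrt s * (s ^ (-(7/8 : ℝ)) * (2 * s ^ (3/8 : ℝ))) = 2 := by
  rw [Real.sqrt_eq_rpow]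
  have h : s ^ (1 / 2 : ℝ) * s ^ (-(7/8 : ℝ)) * s ^ (3/8 : ℝ) = 1 := by
    rw [← Real.rpow_add hs, ← Real.rpow_add hs]
    norm_num
  linear_combination (2 : ℝ) * h

/-- Off the core: if `s > 0` and `2 s^(3/8) ≤ r` then `4 - r² / s^(3/4) ≤ 0`. -/
theorem kinWitness_pointwise_arg_nonpos {s r : ℝ} (hs : 0 < s) (hr : 2 * s ^ (3/8 : ℝ) ≤ r) :
    4 - r ^ 2 / s ^ (3/4 : ℝ) ≤ 0 := by
  have hsq : (s ^ (3/8 : ℝ)) ^ 2 = s ^ (3/4 : ℝ) := by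
    rw [← Real.rpow_natCast, ← Real.rpow_mul hs.le]
    norm_num
  have h34 : 0 < s ^ (3/4 : ℝ) := Real.rpow_pos_of_pos hs _
  have h2 : (2 * s ^ (3/8 : ℝ)) ^ 2 ≤ r ^ 2 := pow_le_pow_left₀ (by positivity) hr 2
  have h4 : 4 * s ^ (3/4 : ℝ) ≤ r ^ 2 := by
    rw [← hsq]
    nlinarith [h2]
  rw [sub_nonpos, le_div_iff₀ h34]
  exact h4

/-- SUPPORT of a slice: for `s > 0` and `2 s^(3/8) ≤ ‖x‖` the slice
`(s^(-7/8) · expNegInvGlue (4 - ‖x‖²/s^(3/4))) • J x` vanishes. -/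
theorem kinWitness_pointwise_slice_eq_zero {s : ℝ} (hs : 0 < s) {x : EuclideanSpace ℝ (Fin 3)}
    (hx : 2 * s ^ (3/8 : ℝ) ≤ ‖x‖) :
    (s ^ (-(7/8 : ℝ)) * expNegInvGlue (4 - ‖x‖ ^ 2 / s ^ (3/4 : ℝ))) •
      (WithLp.toLp 2 ![-(x 1), x 0, 0] : EuclideanSpace ℝ (Fin 3)) = 0 := by
  rw [expNegInvGlue.zero_of_nonpos (kinWitness_pointwise_arg_nonpos hs hx), mul_zero, zero_smul]

/-- Crude size of a slice: `‖(s^(-7/8) · glue) • J x‖ ≤ s^(-7/8) · ‖x‖` (`0 ≤ glue ≤ 1`,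
`‖J x‖ ≤ ‖x‖`). -/
theorem kinWitness_pointwise_norm_slice_le {s : ℝ} (hs : 0 < s) (x : EuclideanSpace ℝ (Fin 3)) :
    ‖(s ^ (-(7/8 : ℝ)) * expNegInvGlue (4 - ‖x‖ ^ 2 / s ^ (3/4 : ℝ))) •
      (WithLp.toLp 2 ![-(x 1), x 0, 0] : EuclideanSpace ℝ (Fin 3))‖ ≤ s ^ (-(7/8 : ℝ)) * ‖x‖ := by
  rw [norm_smul, Real.norm_eq_abs,
    abs_of_nonneg (mul_nonneg (Real.rpow_nonneg hs.le _) (expNegInvGlue.nonneg _))]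
  refine mul_le_mul ?_ (kinWitness_pointwise_norm_rot_le x) (norm_nonneg _)
    (Real.rpow_nonneg hs.le _)
  refine mul_le_of_le_one_right (Real.rpow_nonneg hs.le _) ?_
  -- `expNegInvGlue y ≤ 1`: it is `0` for `y ≤ 0` and `exp (-y⁻¹) ≤ exp 0 = 1` for `y > 0`.
  unfold expNegInvGlue
  split_ifs with h
  · exact zero_le_one
  · exact Real.exp_le_one_iff.mpr (neg_nonpos.mpr (inv_nonneg.mpr (le_of_lt (not_le.mp h))))

/-- TYPE-I BOUND of a slice: `√s · ‖(s^(-7/8) · glue) • J x‖ ≤ 2` for `s > 0`. -/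
theorem kinWitness_pointwise_sqrt_mul_norm_slice_le {s : ℝ} (hs : 0 < s)
    (x : EuclideanSpace ℝ (Fin 3)) :
    Real.sqrt s * ‖(s ^ (-(7/8 : ℝ)) * expNegInvGlue (4 - ‖x‖ ^ 2 / s ^ (3/4 : ℝ))) •
      (WithLp.toLp 2 ![-(x 1), x 0, 0] : EuclideanSpace ℝ (Fin 3))‖ ≤ 2 := by
  rcases le_or_gt (2 * s ^ (3/8 : ℝ)) ‖x‖ with hx | hx
  · rw [kinWitness_pointwise_slice_eq_zero hs hx, norm_zero, mul_zero]
    norm_num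
  · refine (mul_le_mul_of_nonneg_left (kinWitness_pointwise_norm_slice_le hs x)
      (Real.sqrt_nonneg _)).trans ?_
    rw [← kinWitness_pointwise_rpow_cancel hs]
    gcongr

/-- CONTINUITY of a slice `x ↦ (c · expNegInvGlue (4 - ‖x‖²/ρ2)) • J x` (composition of
continuous maps; `expNegInvGlue` is smooth). -/
theorem kinWitness_pointwise_continuous_slice (c ρ2 : ℝ) :
    Continuous fun x : EuclideanSpace ℝ (Fin 3) =>
      (c * expNegInvGlue (4 - ‖x‖ ^ 2 / ρ2)) •
        (WithLp.toLp 2 ![-(x 1), x 0, 0] : EuclideanSpace ℝ (Fin 3)) := by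
  have hg : Continuous expNegInvGlue := (expNegInvGlue.contDiff (n := 0)).continuous
  fun_prop

/-- ENERGY of a slice: for `0 < s ≤ 1` the slice is in `L²(ℝ³)` and
`∫ ‖slice‖² ≤ 32 · (volume (ball 0 1)).toReal` (support in `closedBall 0 (2 s^(3/8))`,
`‖slice‖² ≤ 4/s`, `volume (ball 0 R) = R³ · volume (ball 0 1)`, `(4/s) · 8 s^(9/8) = 32 s^(1/8) ≤ 32`). -/
theorem kinWitness_pointwise_energy_slice {s : ℝ} (hs : 0 < s) (hs1 : s ≤ 1) :
    MemLp (fun x : EuclideanSpace ℝ (Fin 3) =>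
      (s ^ (-(7/8 : ℝ)) * expNegInvGlue (4 - ‖x‖ ^ 2 / s ^ (3/4 : ℝ))) •
        (WithLp.toLp 2 ![-(x 1), x 0, 0] : EuclideanSpace ℝ (Fin 3))) 2 volume ∧
    ∫ x : EuclideanSpace ℝ (Fin 3), ‖(s ^ (-(7/8 : ℝ)) * expNegInvGlue (4 - ‖x‖ ^ 2 / s ^ (3/4 : ℝ))) •
        (WithLp.toLp 2 ![-(x 1), x 0, 0] : EuclideanSpace ℝ (Fin 3))‖ ^ 2
      ≤ 32 * (volume (ball (0 : EuclideanSpace ℝ (Fin 3)) 1)).toReal := by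
  set f : EuclideanSpace ℝ (Fin 3) → EuclideanSpace ℝ (Fin 3) := fun x =>
    (s ^ (-(7/8 : ℝ)) * expNegInvGlue (4 - ‖x‖ ^ 2 / s ^ (3/4 : ℝ))) •
      (WithLp.toLp 2 ![-(x 1), x 0, 0] : EuclideanSpace ℝ (Fin 3)) with hf
  set R : ℝ := 2 * s ^ (3/8 : ℝ) with hR
  have hR0 : 0 ≤ R := by positivity
  have hcont : Continuous f := kinWitness_pointwise_continuous_slice _ _
  have hzero : ∀ x, R ≤ ‖x‖ → f x = 0 := fun x hx =>
    kinWitness_pointwise_slice_eq_zero hs hx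
  have hsupp : Function.support f ⊆ closedBall 0 R := by
    intro x hx
    rw [Function.mem_support] at hx
    rw [mem_closedBall, dist_zero_right]
    by_contra h
    exact hx (hzero x (not_le.mp h).le)
  have hcs : HasCompactSupport f :=
    HasCompactSupport.of_support_subset_isCompact (isCompact_closedBall 0 R) hsupp
  refine ⟨hcont.memLp_of_hasCompactSupport hcs, ?_⟩
  have hbound : ∀ x, ‖f x‖ ^ 2 ≤ 4 / s := by
    intro x
    have h := kinWitness_pointwise_sqrt_mul_norm_slice_le hs x
    have h0 : 0 ≤ Real.sqrt s * ‖f x‖ := by positivity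
    have h2 : (Real.sqrt s * ‖f x‖) ^ 2 ≤ 2 ^ 2 := pow_le_pow_left₀ h0 h 2
    rw [mul_pow, Real.sq_sqrt hs.le] at h2
    rw [le_div_iff₀ hs]
    linarith
  have hvol : (volume (ball (0 : EuclideanSpace ℝ (Fin 3)) R)).toReal =
      R ^ 3 * (volume (ball (0 : EuclideanSpace ℝ (Fin 3)) 1)).toReal := by
    rw [Measure.addHaar_ball volume 0 hR0, finrank_euclideanSpace_fin, ENNReal.toReal_mul,
      ENNReal.toReal_ofReal (by positivity)]
  have hR3 : R ^ 3 = 8 * (s ^ (1/8 : ℝ) * s) := by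
    rw [hR, mul_pow]
    congr 1
    · norm_num
    · rw [← Real.rpow_natCast, ← Real.rpow_mul hs.le, ← Real.rpow_add_one hs.ne']
      norm_num
  have h18 : s ^ (1/8 : ℝ) ≤ 1 := Real.rpow_le_one hs.le hs1 (by norm_num)
  have hV : 0 ≤ (volume (ball (0 : EuclideanSpace ℝ (Fin 3)) 1)).toReal := ENNReal.toReal_nonneg
  calc ∫ x, ‖f x‖ ^ 2 = ∫ x in ball (0 : EuclideanSpace ℝ (Fin 3)) R, ‖f x‖ ^ 2 := by
        symm
        apply setIntegral_eq_integral_of_forall_compl_eq_zero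
        intro x hx
        rw [mem_ball_zero_iff, not_lt] at hx
        rw [hzero x hx, norm_zero, zero_pow two_ne_zero]
    _ ≤ ‖∫ x in ball (0 : EuclideanSpace ℝ (Fin 3)) R, ‖f x‖ ^ 2‖ := Real.le_norm_self _
    _ ≤ 4 / s * volume.real (ball (0 : EuclideanSpace ℝ (Fin 3)) R) :=
        norm_setIntegral_le_of_norm_le_const measure_ball_lt_top fun x _ => by
          rw [Real.norm_eq_abs, abs_of_nonneg (by positivity)]
          exact hbound x
    _ = 32 * s ^ (1/8 : ℝ) * (volume (ball (0 : EuclideanSpace ℝ (Fin 3)) 1)).toReal := by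
        rw [measureReal_def, hvol, hR3]
        field_simp
        ring
    _ ≤ 32 * 1 * (volume (ball (0 : EuclideanSpace ℝ (Fin 3)) 1)).toReal := by gcongr
    _ = 32 * (volume (ball (0 : EuclideanSpace ℝ (Fin 3)) 1)).toReal := by ring

/-- **Stub `kinWitness_pointwise`** (crux stmt-NavierStokesRegularity-1423, line `registered`):
the three pointwise/energy facts of the kinematic witness
`uW t x = (1 - t)^(-7/8) · expNegInvGlue (4 - ‖x‖²/(1 - t)^(3/4)) • (-x₁, x₀, 0)` (`t < 1`; `0`
for `t ≥ 1`): (i) it vanishes for `‖x‖ ≥ 2 (1 - t)^(3/8)`; (ii) the Type-I bound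
`√(1 - t) · ‖uW t x‖ ≤ 2`; (iii) a uniform energy bound `∫ ‖uW t ·‖² ≤ E₀` with every slice in
`L²`, for `t ≥ 0`. -/
theorem kinWitness_pointwise : (∀ (t : ℝ) (x : EuclideanSpace ℝ (Fin 3)), t < 1 → 2 * (1 - t) ^ (3/8 : ℝ) ≤ ‖x‖ → (fun (t : ℝ) (x : EuclideanSpace ℝ (Fin 3)) => if t < 1 then ((1 - t) ^ (-(7/8 : ℝ)) * expNegInvGlue (4 - ‖x‖ ^ 2 / (1 - t) ^ (3/4 : ℝ))) • (WithLp.toLp 2 ![-(x 1), x 0, 0] : EuclideanSpace ℝ (Fin 3)) else 0) t x = 0) ∧ (∀ (t : ℝ) (x : EuclideanSpace ℝ (Fin 3)), t < 1 → Real.sqrt (1 - t) * ‖(fun (t : ℝ) (x : EuclideanSpace ℝ (Fin 3)) => if t < 1 then ((1 - t) ^ (-(7/8 : ℝ)) * expNegInvGlue (4 - ‖x‖ ^ 2 / (1 - t) ^ (3/4 : ℝ))) • (WithLp.toLp 2 ![-(x 1), x 0, 0] : EuclideanSpace ℝ (Fin 3)) else 0) t x‖ ≤ 2) ∧ (∃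 E₀ : ℝ, ∀ t : ℝ, 0 ≤ t → MeasureTheory.MemLp ((fun (t : ℝ) (x : EuclideanSpace ℝ (Fin 3)) => if t < 1 then ((1 - t) ^ (-(7/8 : ℝ)) * expNegInvGlue (4 - ‖x‖ ^ 2 / (1 - t) ^ (3/4 : ℝ))) • (WithLp.toLp 2 ![-(x 1), x 0, 0] : EuclideanSpace ℝ (Fin 3)) else 0) t) 2 MeasureTheory.volume ∧ ∫ x, ‖(fun (t : ℝ) (x : EuclideanSpace ℝ (Fin 3)) => if t < 1 then ((1 - t) ^ (-(7/8 : ℝ)) * expNegInvGlue (4 - ‖x‖ ^ 2 / (1 - t) ^ (3/4 : ℝ))) • (WithLp.toLp 2 ![-(x 1), x 0, 0] : EuclideanSpace ℝ (Fin 3)) else 0) t x‖ ^ 2 ≤ E₀) := by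
  refine ⟨fun t x ht hx => ?_, fun t x ht => ?_,
    ⟨32 * (volume (ball (0 : EuclideanSpace ℝ (Fin 3)) 1)).toReal, fun t ht0 => ?_⟩⟩
  · simp only [if_pos ht]
    exact kinWitness_pointwise_slice_eq_zero (sub_pos.mpr ht) hx
  · simp only [if_pos ht]
    exact kinWitness_pointwise_sqrt_mul_norm_slice_le (sub_pos.mpr ht) x
  · by_cases ht : t < 1
    · simp only [if_pos ht]
      exact kinWitness_pointwise_energy_slice (sub_pos.mpr ht) (by linarith)
    · simp only [if_neg ht, norm_zero, ne_eq, OfNat.ofNat_ne_zero, not_false_eq_true, zero_pow,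
        integral_zero]
      exact ⟨MemLp.zero', by positivity⟩

end Summit.NavierStokesRegularity.NavierStokesRegularity.Theorems
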